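import Summits.PneNP.PneNP.Theorems.KarlinRubinMonotoneBlindSwitchRun

/-!
# Route KarlinRubin, crux `MonotoneBlind` (stmt-PneNP-18027): clique-restriction switching — encoding and decoding

Second file of the clique-restriction switching lemma (seat write-up `MonotoneBlind_AC0_announce.md`). A *code* is a
list of entries `(nw, bk)`: the NEW inside slots queried at a stage of the canonical run (`swRun`,
`KarlinRubinMonotoneBlindSwitchRun.lean`) and the black ones among them.

* `swFwd V x P r v₀ code l K B Z` — the **forward process**: the canonical run driven by the code instead of an input
  (skip a clause with a black outside slot or a known black inside slot; otherwise it is a *stage*: the head entry must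
  name exactly the new inside slots of the clause, the clause must have `≤ P` slots and `≤ r` new ones; the revealed
  vertex set `Z` grows by the endpoints of the new slots; SUCCESS `(Z, K)` as soon as `#Z ≥ v₀` with the code exhausted;
  failure if the stage is all white before that);
* `swDec x' P r v₀ code l K B Z` — the **decoder**: the same process WITHOUT the vertex set `V`: a clause is skipped iff
  it has a black slot at the hybrid input (`x'` off the queried set `K`, the recorded blacks `B` on it), and at a stage
  the entry only has to name a subset of the clause;
* `swDec_eq_of_swFwd` — **simulation**: if the forward process succeeds with `(Z, F)` and `x'` agrees with `x` off the
  inside slots and is WHITE on `F`, the decoder (which never sees `V`) outputs the same `Z` (Razborov's "first clause not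
  satisfied by the hybrid restriction" identification, here: first all-white clause);
* `swFwd_sound` — a successful forward run reveals `≥ v₀` vertices of `V`, all slots of `F` are inside `V`, and
  `#F ≤ C(v₀ - 1, 2) + r`;
(Completeness — a long canonical run yields a successful code — is the next file, `…SwitchComplete.lean`.)

All `--supports stmt-PneNP-18027`. Definitions: the two processes (structural recursions on the clause list).
-/

set_option linter.dupNamespace false -- `Summit.PneNP.PneNP.…`: summit = sub-problem (D-0017)

namespace Summit.PneNP.PneNP.Theorems

open Finset
open Literature.Computability.Complexity
open Literature.Probability.RandomGraphs.PlantedClique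

variable {n : ℕ}

/-! ### The forward process and the decoder -/

open Classical in
/-- **Forward process** (canonical run driven by a code; see the module docstring). [cite: Beame1994, §3] -/
noncomputable def swFwd (V : Finset (Fin n)) (x : EdgeVec n) (P r v₀ : ℕ) :
    List (Finset (⊤ : SimpleGraph (Fin n)).edgeSet × Finset (⊤ : SimpleGraph (Fin n)).edgeSet) →
      List (Finset (⊤ : SimpleGraph (Fin n)).edgeSet) → Finset (⊤ : SimpleGraph (Fin n)).edgeSet →
        Finset (⊤ : SimpleGraph (Fin n)).edgeSet → Finset (Fin n) →
          Option (Finset (Fin n) × Finset (⊤ : SimpleGraph (Fin n)).edgeSet)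
  | _, [], _, _, _ => none
  | code, S :: l, K, B, Z =>
    if ∃ e ∈ S, (¬ ∀ v ∈ (e : Sym2 (Fin n)), v ∈ V) ∧ x e = true then swFwd V x P r v₀ code l K B Z
    else if ∃ e ∈ S, e ∈ B then swFwd V x P r v₀ code l K B Z
    else match code with
      | [] => none
      | (nw, bk) :: code' =>
        if nw = (S.filter fun e : (⊤ : SimpleGraph (Fin n)).edgeSet => ∀ v ∈ (e : Sym2 (Fin n)), v ∈ V) \ K ∧ bk ⊆ nw ∧ #S ≤ P ∧ #nw ≤ r then
          if v₀ ≤ #(Z ∪ univ.filter fun v : Fin n => ∃ e ∈ nw, v ∈ (e : Sym2 (Fin n))) then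
            (if code' = [] then some (Z ∪ univ.filter (fun v : Fin n => ∃ e ∈ nw, v ∈ (e : Sym2 (Fin n))), K ∪ nw)
              else none)
          else if bk = ∅ then none
          else swFwd V x P r v₀ code' l (K ∪ nw) (B ∪ bk)
            (Z ∪ univ.filter fun v : Fin n => ∃ e ∈ nw, v ∈ (e : Sym2 (Fin n)))
        else none

open Classical in
/-- **Decoder** (the forward process without the vertex set; see the module docstring). [cite: Beame1994, §3] -/
noncomputable def swDec (x' : EdgeVec n) (P r v₀ : ℕ) :
    List (Finset (⊤ : SimpleGraph (Fin n)).edgeSet × Finset (⊤ : SimpleGraph (Fin n)).edgeSet) →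
      List (Finset (⊤ : SimpleGraph (Fin n)).edgeSet) → Finset (⊤ : SimpleGraph (Fin n)).edgeSet →
        Finset (⊤ : SimpleGraph (Fin n)).edgeSet → Finset (Fin n) → Option (Finset (Fin n))
  | _, [], _, _, _ => none
  | code, S :: l, K, B, Z =>
    if ∃ e ∈ S, (e ∉ K ∧ x' e = true) ∨ e ∈ B then swDec x' P r v₀ code l K B Z
    else match code with
      | [] => none
      | (nw, bk) :: code' =>
        if nw ⊆ S ∧ bk ⊆ nw ∧ #S ≤ P ∧ #nw ≤ r then
          if v₀ ≤ #(Z ∪ univ.filter fun v : Fin n => ∃ e ∈ nw, v ∈ (e : Sym2 (Fin n))) then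
            (if code' = [] then some (Z ∪ univ.filter fun v : Fin n => ∃ e ∈ nw, v ∈ (e : Sym2 (Fin n))) else none)
          else if bk = ∅ then none
          else swDec x' P r v₀ code' l (K ∪ nw) (B ∪ bk)
            (Z ∪ univ.filter fun v : Fin n => ∃ e ∈ nw, v ∈ (e : Sym2 (Fin n)))
        else none

variable (V : Finset (Fin n)) (x : EdgeVec n) (P r v₀ : ℕ)

/-- The forward process fails on the empty clause list. [folklore] -/
@[simp] theorem swFwd_nil (code : List (Finset (⊤ : SimpleGraph (Fin n)).edgeSet × Finset (⊤ : SimpleGraph (Fin n)).edgeSet))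
    (K B : Finset (⊤ : SimpleGraph (Fin n)).edgeSet) (Z : Finset (Fin n)) :
    swFwd V x P r v₀ code [] K B Z = none := by
  cases code <;> rfl

/-- The decoder fails on the empty clause list. [folklore] -/
@[simp] theorem swDec_nil (x' : EdgeVec n)
    (code : List (Finset (⊤ : SimpleGraph (Fin n)).edgeSet × Finset (⊤ : SimpleGraph (Fin n)).edgeSet))
    (K B : Finset (⊤ : SimpleGraph (Fin n)).edgeSet) (Z : Finset (Fin n)) :
    swDec x' P r v₀ code [] K B Z = none := by
  cases code <;> rfl

open Classical in
/-- One step of the forward process (definitional unfolding). [folklore] -/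
theorem swFwd_cons (code : List (Finset (⊤ : SimpleGraph (Fin n)).edgeSet × Finset (⊤ : SimpleGraph (Fin n)).edgeSet))
    (S : Finset (⊤ : SimpleGraph (Fin n)).edgeSet) (l : List (Finset (⊤ : SimpleGraph (Fin n)).edgeSet))
    (K B : Finset (⊤ : SimpleGraph (Fin n)).edgeSet) (Z : Finset (Fin n)) :
    swFwd V x P r v₀ code (S :: l) K B Z =
      if ∃ e ∈ S, (¬ ∀ v ∈ (e : Sym2 (Fin n)), v ∈ V) ∧ x e = true then swFwd V x P r v₀ code l K B Z
      else if ∃ e ∈ S, e ∈ B then swFwd V x P r v₀ code l K B Z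
      else match code with
        | [] => none
        | (nw, bk) :: code' =>
          if nw = (S.filter fun e : (⊤ : SimpleGraph (Fin n)).edgeSet => ∀ v ∈ (e : Sym2 (Fin n)), v ∈ V) \ K ∧ bk ⊆ nw ∧ #S ≤ P ∧ #nw ≤ r then
            if v₀ ≤ #(Z ∪ univ.filter fun v : Fin n => ∃ e ∈ nw, v ∈ (e : Sym2 (Fin n))) then
              (if code' = [] then some (Z ∪ univ.filter (fun v : Fin n => ∃ e ∈ nw, v ∈ (e : Sym2 (Fin n))), K ∪ nw)
                else none)
            else if bk = ∅ then none
            else swFwd V x P r v₀ code' l (K ∪ nw) (B ∪ bk)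
              (Z ∪ univ.filter fun v : Fin n => ∃ e ∈ nw, v ∈ (e : Sym2 (Fin n)))
          else none := by
  cases code <;> rfl

open Classical in
/-- One step of the decoder (definitional unfolding). [folklore] -/
theorem swDec_cons (x' : EdgeVec n)
    (code : List (Finset (⊤ : SimpleGraph (Fin n)).edgeSet × Finset (⊤ : SimpleGraph (Fin n)).edgeSet))
    (S : Finset (⊤ : SimpleGraph (Fin n)).edgeSet) (l : List (Finset (⊤ : SimpleGraph (Fin n)).edgeSet))
    (K B : Finset (⊤ : SimpleGraph (Fin n)).edgeSet) (Z : Finset (Fin n)) :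
    swDec x' P r v₀ code (S :: l) K B Z =
      if ∃ e ∈ S, (e ∉ K ∧ x' e = true) ∨ e ∈ B then swDec x' P r v₀ code l K B Z
      else match code with
        | [] => none
        | (nw, bk) :: code' =>
          if nw ⊆ S ∧ bk ⊆ nw ∧ #S ≤ P ∧ #nw ≤ r then
            if v₀ ≤ #(Z ∪ univ.filter fun v : Fin n => ∃ e ∈ nw, v ∈ (e : Sym2 (Fin n))) then
              (if code' = [] then some (Z ∪ univ.filter fun v : Fin n => ∃ e ∈ nw, v ∈ (e : Sym2 (Fin n))) else none)
            else if bk = ∅ then none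
            else swDec x' P r v₀ code' l (K ∪ nw) (B ∪ bk)
              (Z ∪ univ.filter fun v : Fin n => ∃ e ∈ nw, v ∈ (e : Sym2 (Fin n)))
          else none := by
  cases code <;> rfl

/-! ### Simulation: the decoder follows a successful forward run -/

open Classical in
/-- The initial queried set is contained in the final one of a successful forward run. [folklore] -/
theorem subset_of_swFwd_eq_some :
    ∀ (code : List (Finset (⊤ : SimpleGraph (Fin n)).edgeSet × Finset (⊤ : SimpleGraph (Fin n)).edgeSet))
      (l : List (Finset (⊤ : SimpleGraph (Fin n)).edgeSet)) (K B : Finset (⊤ : SimpleGraph (Fin n)).edgeSet)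
      (Z Zf : Finset (Fin n)) (F : Finset (⊤ : SimpleGraph (Fin n)).edgeSet),
      swFwd V x P r v₀ code l K B Z = some (Zf, F) → K ⊆ F := by
  intro code l
  induction l generalizing code with
  | nil => intro K B Z Zf F h; simp at h
  | cons S l ih =>
    intro K B Z Zf F h
    rw [swFwd_cons] at h
    split_ifs at h with h1 h2
    · exact ih code K B Z Zf F h
    · exact ih code K B Z Zf F h
    · match code, h with
      | (nw, bk) :: code', h =>
        simp only at h
        split_ifs at h with h3 h4 h5 h6
        · simp only [Option.some.injEq, Prod.mk.injEq] at h
          rw [← h.2]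
          exact subset_union_left
        · exact subset_union_left.trans (ih code' _ _ _ Zf F h)

open Classical in
/-- **Simulation.** If the forward process succeeds with `(Zf, F)` from a state with `B ⊆ K ⊆ inside V`, and `x'`
agrees with `x` on the slots not inside `V` and is white on `F`, then the decoder run on `x'` from the same state
outputs `Zf`. [cite: Beame1994, §3] -/
theorem swDec_eq_of_swFwd {x' : EdgeVec n}
    (hxx' : ∀ e : (⊤ : SimpleGraph (Fin n)).edgeSet, (¬ ∀ v ∈ (e : Sym2 (Fin n)), v ∈ V) → x' e = x e) :
    ∀ (code : List (Finset (⊤ : SimpleGraph (Fin n)).edgeSet × Finset (⊤ : SimpleGraph (Fin n)).edgeSet))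
      (l : List (Finset (⊤ : SimpleGraph (Fin n)).edgeSet)) (K B : Finset (⊤ : SimpleGraph (Fin n)).edgeSet)
      (Z Zf : Finset (Fin n)) (F : Finset (⊤ : SimpleGraph (Fin n)).edgeSet),
      B ⊆ K → (∀ e ∈ K, ∀ v ∈ (e : Sym2 (Fin n)), v ∈ V) → (∀ e ∈ F, x' e = false) →
      swFwd V x P r v₀ code l K B Z = some (Zf, F) → swDec x' P r v₀ code l K B Z = some Zf := by
  intro code l
  induction l generalizing code with
  | nil => intro K B Z Zf F _ _ _ h; simp at h
  | cons S l ih =>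
    intro K B Z Zf F hBK hKin hF h
    have hKF : K ⊆ F := subset_of_swFwd_eq_some V x P r v₀ code (S :: l) K B Z Zf F h
    rw [swFwd_cons] at h
    rw [swDec_cons]
    by_cases h1 : ∃ e ∈ S, (¬ ∀ v ∈ (e : Sym2 (Fin n)), v ∈ V) ∧ x e = true
    · -- skipped: a black outside slot, black in `x'` too and not queried
      rw [if_pos h1] at h
      obtain ⟨e, he, he1, he2⟩ := h1
      have hskip : ∃ e ∈ S, (e ∉ K ∧ x' e = true) ∨ e ∈ B :=
        ⟨e, he, Or.inl ⟨fun heK => he1 (hKin e heK), by rw [hxx' e he1]; exact he2⟩⟩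
      rw [if_pos hskip]
      exact ih code K B Z Zf F hBK hKin hF h
    rw [if_neg h1] at h
    by_cases h2 : ∃ e ∈ S, e ∈ B
    · rw [if_pos h2] at h
      obtain ⟨e, he, heB⟩ := h2
      have hskip : ∃ e ∈ S, (e ∉ K ∧ x' e = true) ∨ e ∈ B := ⟨e, he, Or.inr heB⟩
      rw [if_pos hskip]
      exact ih code K B Z Zf F hBK hKin hF h
    rw [if_neg h2] at h
    -- a stage of the forward process
    match code, h with
    | [], h => simp at h
    | (nw, bk) :: code', h =>
      simp only at h
      by_cases h3 : nw = (S.filter fun e : (⊤ : SimpleGraph (Fin n)).edgeSet => ∀ v ∈ (e : Sym2 (Fin n)), v ∈ V) \ K ∧ bk ⊆ nw ∧ #S ≤ P ∧ #nw ≤ r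
      swap
      · rw [if_neg h3] at h; simp at h
      rw [if_pos h3] at h
      obtain ⟨hnw, hbk, hSP, hnwr⟩ := h3
      -- the new slots are in `F`, hence white in `x'`
      have hnwF : nw ⊆ F := by
        split_ifs at h with h4 h5 h6
        · simp only [Option.some.injEq, Prod.mk.injEq] at h
          rw [← h.2]
          exact subset_union_right
        · exact (subset_union_right).trans (subset_of_swFwd_eq_some V x P r v₀ code' l _ _ _ Zf F h)
      -- the decoder does not skip `S`: every slot of `S` is white at the hybrid input
      have hnoskip : ¬ ∃ e ∈ S, (e ∉ K ∧ x' e = true) ∨ e ∈ B := by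
        rintro ⟨e, he, (⟨heK, hxe⟩ | heB)⟩
        · by_cases hein : ∀ v ∈ (e : Sym2 (Fin n)), v ∈ V
          · have henw : e ∈ nw := by
              rw [hnw, mem_sdiff, mem_filter]
              exact ⟨⟨he, hein⟩, heK⟩
            rw [hF e (hnwF henw)] at hxe
            exact Bool.false_ne_true hxe
          · rw [hxx' e hein] at hxe
            exact h1 ⟨e, he, hein, hxe⟩
        · exact h2 ⟨e, he, heB⟩
      rw [if_neg hnoskip]
      simp only
      have h3' : nw ⊆ S ∧ bk ⊆ nw ∧ #S ≤ P ∧ #nw ≤ r := by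
        refine ⟨?_, hbk, hSP, hnwr⟩
        rw [hnw]
        exact sdiff_subset.trans (filter_subset _ _)
      rw [if_pos h3']
      split_ifs at h with h4 h5 h6
      · simp only [Option.some.injEq, Prod.mk.injEq] at h
        rw [if_pos h4, if_pos h5, h.1]
      · rw [if_neg h4, if_neg h6]
        refine ih code' (K ∪ nw) (B ∪ bk) _ Zf F ?_ ?_ hF h
        · exact union_subset_union hBK hbk
        · intro e he
          rcases mem_union.1 he with he | he
          · exact hKin e he
          · rw [hnw, mem_sdiff, mem_filter] at he
            exact he.1.2

/-! ### Soundness of a successful forward run -/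

/-- A slot set all of whose slots lie inside `W` has at most `C(#W, 2)` slots. [folklore] -/
theorem card_le_choose_two_of_inside (W : Finset (Fin n)) (T : Finset (⊤ : SimpleGraph (Fin n)).edgeSet)
    (hT : ∀ e ∈ T, ∀ v ∈ (e : Sym2 (Fin n)), v ∈ W) : #T ≤ (#W).choose 2 := by
  classical
  have h := card_filter_inside_le_choose W T
  have hfilt : (T.filter fun e : (⊤ : SimpleGraph (Fin n)).edgeSet => ∀ v ∈ (e : Sym2 (Fin n)), v ∈ W) = T :=
    filter_true_of_mem hT
  rw [hfilt] at h
  exact h.trans (Nat.choose_le_choose 2 (card_le_card inter_subset_left))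

open Classical in
/-- **Soundness.** From a state with `K` inside `V`, `Z ⊆ V`, every slot of `K` inside `Z` and `#Z < v₀`, a successful
forward run outputs `(Zf, F)` with `Z ⊆ Zf ⊆ V`, `v₀ ≤ #Zf`, every slot of `F` inside `V`, and `#F ≤ C(v₀-1,2) + r`.
[folklore] -/
theorem swFwd_sound :
    ∀ (code : List (Finset (⊤ : SimpleGraph (Fin n)).edgeSet × Finset (⊤ : SimpleGraph (Fin n)).edgeSet))
      (l : List (Finset (⊤ : SimpleGraph (Fin n)).edgeSet)) (K B : Finset (⊤ : SimpleGraph (Fin n)).edgeSet)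
      (Z Zf : Finset (Fin n)) (F : Finset (⊤ : SimpleGraph (Fin n)).edgeSet),
      (∀ e ∈ K, ∀ v ∈ (e : Sym2 (Fin n)), v ∈ Z) → Z ⊆ V → #Z < v₀ →
      swFwd V x P r v₀ code l K B Z = some (Zf, F) →
        Zf ⊆ V ∧ v₀ ≤ #Zf ∧ (∀ e ∈ F, ∀ v ∈ (e : Sym2 (Fin n)), v ∈ V) ∧ #F ≤ (v₀ - 1).choose 2 + r := by
  intro code l
  induction l generalizing code with
  | nil => intro K B Z Zf F _ _ _ h; simp at h
  | cons S l ih =>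
    intro K B Z Zf F hKZ hZV hZlt h
    rw [swFwd_cons] at h
    split_ifs at h with h1 h2
    · exact ih code K B Z Zf F hKZ hZV hZlt h
    · exact ih code K B Z Zf F hKZ hZV hZlt h
    · match code, h with
      | [], h => simp at h
      | (nw, bk) :: code', h =>
        simp only at h
        by_cases h3 : nw = (S.filter fun e : (⊤ : SimpleGraph (Fin n)).edgeSet => ∀ v ∈ (e : Sym2 (Fin n)), v ∈ V) \ K ∧ bk ⊆ nw ∧ #S ≤ P ∧ #nw ≤ r
        swap
        · rw [if_neg h3] at h; simp at h
        rw [if_pos h3] at h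
        obtain ⟨hnw, -, -, hnwr⟩ := h3
        set Z' := Z ∪ univ.filter fun v : Fin n => ∃ e ∈ nw, v ∈ (e : Sym2 (Fin n)) with hZ'
        have hnwin : ∀ e ∈ nw, ∀ v ∈ (e : Sym2 (Fin n)), v ∈ V := by
          intro e he
          rw [hnw, mem_sdiff, mem_filter] at he
          exact he.1.2
        have hZ'V : Z' ⊆ V := by
          refine union_subset hZV fun v hv => ?_
          rw [mem_filter] at hv
          obtain ⟨-, e, he, hve⟩ := hv
          exact hnwin e he v hve
        have hK'Z' : ∀ e ∈ K ∪ nw, ∀ v ∈ (e : Sym2 (Fin n)), v ∈ Z' := by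
          intro e he v hv
          rcases mem_union.1 he with he | he
          · exact mem_union_left _ (hKZ e he v hv)
          · exact mem_union_right _ (mem_filter.2 ⟨mem_univ _, e, he, hv⟩)
        have hKcard : #K ≤ (v₀ - 1).choose 2 :=
          (card_le_choose_two_of_inside Z K hKZ).trans (Nat.choose_le_choose 2 (by omega))
        split_ifs at h with h4 h5 h6
        · simp only [Option.some.injEq, Prod.mk.injEq] at h
          obtain ⟨rfl, rfl⟩ := h
          refine ⟨hZ'V, h4, ?_, ?_⟩
          · intro e he
            rcases mem_union.1 he with he | he
            · exact fun v hv => hZV (hKZ e he v hv)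
            · exact hnwin e he
          · exact (card_union_le _ _).trans (add_le_add hKcard hnwr)
        · exact ih code' (K ∪ nw) _ Z' Zf F hK'Z' hZ'V (not_le.1 h4) h

end Summit.PneNP.PneNP.Theorems

/-- Registered stub `stub_switchCode` of the clique-restriction switching line (this file's self-contained counting
content: a slot set inside `W` has `≤ C(#W, 2)` slots — the bound on the forced set of the encoding). [folklore] -/
theorem Summit.PneNP.PneNP.Theorems.stub_switchCode :
    ∀ (n : ℕ) (W : Finset (Fin n)) (T : Finset ((⊤ : SimpleGraph (Fin n)).edgeSet)),
      (∀ e ∈ T, ∀ v ∈ (e : Sym2 (Fin n)), v ∈ W) → T.card ≤ (W.card).choose 2 :=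
  fun _ W T hT => Summit.PneNP.PneNP.Theorems.card_le_choose_two_of_inside W T hT
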